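import Literature.MathematicalPhysics.QuantumFieldTheory.Balaban1983to89.B15FibreLemmaSupp

/-!
# `Balaban1983to89.B15RopTotalSupp` — T. Bałaban, *Large field renormalization. I. The basic step of the 𝐑 operation*,
# Commun. Math. Phys. **122** (1989) 175–202 [Balaban1989LargeFieldI], (0.3)–(0.4) p. 176: the TOTAL 𝐑-operator of
# `B15RopTotal` RE-ISSUED OVER THE SUPPORT-FORM PROVISOS of `B15FibreLemmaSupp` (append-only successor; no landed decl touched)

statement-level skeleton of published theorems with citation tags; proofs where landed; nothing here is a claim about
the Yang–Mills mass gap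

WHY (cell `pub-ymgap`, HUMAN RULING D-0062; seat `pub-ymgap-dag-n12-b`, owner of `B15RopTotal`; dag-lead [FLAG-(R-C2)],
dag-n12-a `B15LeafKnitMass` §1, definer node00-def-R's caveat (R-C1) typed by dag-n10-b as `B15FibreLemmaSupp`).  The
fourth conjunct of `B15RopTotal.RepData.Provisos` — every denominator fibre integral `∫dV⌈_{Z′}ρ(Z″,·)` NOWHERE zero — is
unsatisfiable at Bałaban's genuine (2.18) pieces (indicator characteristic functions off `Z′`), so the (0.3) branch of
`ropTotal` never fires there.  `B15FibreLemmaSupp` (p416095) re-proved b01's (0.4) chain under the SUPPORT FORM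
`∫⌈_{Z′}ρ(Z″,·)(V) = 0 ⇒ ρ(Z, V) = 0` (`RepData.ProvisosSupp`, `integral_rop_eq_of_provisosSupp`, `integrable_normTerm_supp`)
and left *«the v1.2 pin over `AdmissibleSupp`»* to the definer's successor.  THIS FILE is that operator-level successor:
`AdmissibleSupp`, `ropTotalSupp` (Bałaban's (0.3) on support-form-admissible densities, identity elsewhere),
`preservesIntegral_ropTotalSupp` ((0.4) FOR EVERY DENSITY), `integrable_ropTotalSupp`, `ropTotalSupp_nonneg`, and the
comparison with v1 (`admissibleSupp_of_admissible`, `ropTotalSupp_eq_ropTotal_of_admissible`) — so DEFINER ₇'s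
`ROp03OfRecord := ropTotal (rep p k)` can switch to `ropTotalSupp (rep p k)` by name.
HONEST SCOPE.  Definitions over a typed proviso + kernel bookkeeping on n10-b's PROVED support-form chain; nothing of
Bałaban's asserted; no estimate; counts unmoved; NOT continuum ∕ OS ∕ mass-gap ∕ Clay.  No `sorry`, no instance, no notation.
-/

noncomputable section

open MeasureTheory
open scoped BigOperators

namespace Literature.MathematicalPhysics.QuantumFieldTheory.Balaban1983to89.B15RopTotal

open B15.BasicStep (fibreIntegral normTerm RopReal integrable_normTerm_supp)

variable {P : Params} {j : ℕ} {G : Type*} [GaugeGroup G] [MeasurableSpace G] [HaarData G] [DecidableEq (PBond P j)]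

/-- `ρ` is ADMISSIBLE IN SUPPORT FORM for the representation datum `rep`: the datum represents it and satisfies the
support-form provisos `RepData.ProvisosSupp` of `B15FibreLemmaSupp`. [cite: Balaban1989LargeFieldI, (0.2)–(0.3) p.176] -/
def AdmissibleSupp (rep : Density P j G → RepData P j G) (ρ : Density P j G) : Prop :=
  (rep ρ).total = ρ ∧ (rep ρ).ProvisosSupp

/-- v1 admissibility (pointwise denominators) implies support-form admissibility. [cite: Balaban1989LargeFieldI, (0.3) p.176 (bookkeeping)] -/
theorem admissibleSupp_of_admissible {rep : Density P j G → RepData P j G} {ρ : Density P j G} (h : Admissible rep ρ) :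
    AdmissibleSupp rep ρ :=
  ⟨h.1, (rep ρ).provisosSupp_of_provisos h.2⟩

open Classical in
/-- **𝐑 as a TOTAL operator, SUPPORT FORM**: (0.3) of the datum on the support-form-admissible densities, the identity
elsewhere — the successor of `ropTotal` whose Bałaban branch CAN fire at genuine χ-pieces. [cite: Balaban1989LargeFieldI, (0.3) p.176] -/
def ropTotalSupp (rep : Density P j G → RepData P j G) : Density P j G → Density P j G :=
  fun ρ => if AdmissibleSupp rep ρ then (rep ρ).rop else ρ

/-- The admissible branch: `ropTotalSupp rep ρ = (0.3)` of the datum. [cite: Balaban1989LargeFieldI, (0.3) p.176] -/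
theorem ropTotalSupp_of_admissible {rep : Density P j G → RepData P j G} {ρ : Density P j G} (h : AdmissibleSupp rep ρ) :
    ropTotalSupp rep ρ = (rep ρ).rop := by
  classical
  exact if_pos h

/-- The identity branch. [cite: Balaban1989LargeFieldI, (0.3) p.176 (typing convention D-b01.2)] -/
theorem ropTotalSupp_of_not {rep : Density P j G → RepData P j G} {ρ : Density P j G} (h : ¬ AdmissibleSupp rep ρ) :
    ropTotalSupp rep ρ = ρ := by
  classical
  exact if_neg h

/-- On v1-admissible densities the two total operators agree (both are (0.3) of the datum). [cite: Balaban1989LargeFieldI, (0.3) p.176 (bookkeeping)] -/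
theorem ropTotalSupp_eq_ropTotal_of_admissible {rep : Density P j G → RepData P j G} {ρ : Density P j G}
    (h : Admissible rep ρ) : ropTotalSupp rep ρ = ropTotal rep ρ := by
  rw [ropTotalSupp_of_admissible (admissibleSupp_of_admissible h), ropTotal_of_admissible h]

/-- **(0.4) for the support-form total operator, for EVERY density**: `∫dV(𝐑ρ)(V) = ∫dVρ(V)` — on the admissible branch by
n10-b's `RepData.integral_rop_eq_of_provisosSupp`, on the other branch trivially. [cite: Balaban1989LargeFieldI, (0.4) p.176] -/
theorem preservesIntegral_ropTotalSupp (rep : Density P j G → RepData P j G) : PreservesIntegral (ropTotalSupp rep) := by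
  classical
  intro ρ
  by_cases h : AdmissibleSupp rep ρ
  · rw [ropTotalSupp_of_admissible h, (rep ρ).integral_rop_eq_of_provisosSupp h.2, h.1]
  · rw [ropTotalSupp_of_not h]

/-- **Integrability is preserved by the support-form total operator, for EVERY density** (admissible branch: each
(0.3)-term is integrable by n10-b's `integrable_normTerm_supp`; other branch: `ρ` itself). [cite: Balaban1989LargeFieldI, (0.3)–(0.4) p.176] -/
theorem integrable_ropTotalSupp (rep : Density P j G → RepData P j G) {ρ : Density P j G}
    (hρ : Integrable ρ (fieldMeasure P j G)) : Integrable (ropTotalSupp rep ρ) (fieldMeasure P j G) := by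
  classical
  by_cases h : AdmissibleSupp rep ρ
  · rw [ropTotalSupp_of_admissible h]
    letI := (rep ρ).fin
    obtain ⟨-, hm, h0, ⟨C, hC⟩, hsupp⟩ := h
    have hterm : ∀ Z, Integrable (normTerm ((rep ρ).fib Z) ((rep ρ).piece ((rep ρ).pp Z)) ((rep ρ).piece Z))
        (fieldMeasure P j G) :=
      fun Z => integrable_normTerm_supp _ (hm _) (hm _) (h0 _) (hC _) (hC _) (hsupp Z)
    have hsum : Integrable (fun V => ∑ Z, normTerm ((rep ρ).fib Z) ((rep ρ).piece ((rep ρ).pp Z)) ((rep ρ).piece Z) V)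
        (fieldMeasure P j G) := integrable_finsetSum _ fun Z _ => hterm Z
    exact hsum
  · rw [ropTotalSupp_of_not h]; exact hρ

/-- Non-negativity on the admissible branch (support form): quotients of non-negative fibre integrals of non-negative pieces.
[cite: Balaban1989LargeFieldI, (0.3) p.176] -/
theorem ropTotalSupp_nonneg {rep : Density P j G → RepData P j G} {ρ : Density P j G} (h : AdmissibleSupp rep ρ)
    (V : GaugeField P j G) : 0 ≤ ropTotalSupp rep ρ V := by
  rw [ropTotalSupp_of_admissible h]
  letI := (rep ρ).fin
  obtain ⟨-, -, h0, -, -⟩ := h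
  unfold RepData.rop RopReal
  refine Finset.sum_nonneg fun Z _ => ?_
  unfold normTerm fibreIntegral
  exact mul_nonneg (h0 _ _) (div_nonneg ENNReal.toReal_nonneg ENNReal.toReal_nonneg)

end Literature.MathematicalPhysics.QuantumFieldTheory.Balaban1983to89.B15RopTotal

end
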